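import Literature.Probability.FitznerVanDerHofstad2017.F3BoundsD75
import HarnessLib

/-!
# The `f₃` bound map is monotone in the SRW tables

[NoBLE16] §3.3.5 (3.71)–(3.87) bound the Laplacian integrals `ℋ^{n,l}_{i,z}(x)` by expressions `BoundH[i, …]` that are
LINEAR in the SRW tables `IM` (= `𝒥`), `T`, `U`, `K` with coefficients that are non-negative on well-formed arguments
(`F3Bounds.Args.WF`: `α̲_F > 0`, every other `β` `≥ 0`).  Hence every `BoundH[i]`, their sum, the cell maxima
`BoundFThree*` and the initial-point cells `BoundFThreeInitial*` are MONOTONE (non-decreasing) in the tables, entry by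
entry.  This is the glue between the two halves of the (S2b)-IMPR chain: the Step leaves
(`NobleH4StepD75.abs_integral_H4_diagram_le_boundH4D75`, `NobleH35Step`, `NobleH2Step`, …) are stated at the TRUE SRW
integrals (`τ.K = srwK`, `τ.U = srwU`, `srwTS ≤ τ.T`), while `Stage1Frame` and the `d = 11` certificates evaluate the map at
CERTIFIED CELL tables dominating them (`MeanFieldD11Stage1TabsIX`, `MeanFieldD11Stage1TabsTU`): `Tables.Dom true cells`
transports each leaf to the cells.

Contents: the entrywise order `F3Bounds.Tables.Dom` (reflexive, transitive; `Tables.Nonneg` ascends along it); table-monotonicity of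
`boundH1`, `boundH2`, `boundH3`, `boundH3Mono`, `boundH4`, `boundH4D75`, `boundH5`, `boundH`, `boundHMono`, `boundHD75`,
`boundHMonoD75`, `boundFThree`, `boundFThreeMono`, `boundFThreeD75`, `boundFThreeMonoD75` (well-formed arguments) and of
`boundFThreeInitial`, `boundFThreeInitialPrinted` (`rho ≥ 0`, `d ≥ 1`).

b2b-lace packet, LEAN TYPING SEAT 2 gen 15 (unit `b2b-lace-lean2-g15`), node (S2b)-IMPR-TABMONO.  `F3Bounds.lean` and
`F3BoundsD75.lean` are UNCHANGED; nothing here is a cited fact (elementary order algebra, [folklore]); no dimension is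
mentioned.
-/

noncomputable section

namespace Literature.Probability.FitznerVanDerHofstad2017
namespace F3Bounds

variable {ν : Type*}

/-- The entrywise order on SRW tables: every entry of `τ` is at most the corresponding entry of `τ'` (e.g. `τ` = the true
SRW integrals, `τ'` = certified interval upper ends). [folklore] -/
structure Tables.Dom (τ τ' : Tables ν) : Prop where
  IM : ∀ n l v, τ.IM n l v ≤ τ'.IM n l v
  T : ∀ n l v, τ.T n l v ≤ τ'.T n l v
  U : ∀ n l v, τ.U n l v ≤ τ'.U n l v
  K : ∀ n l v, τ.K n l v ≤ τ'.K n l v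

/-- The entrywise order is reflexive. [folklore] -/
theorem Tables.Dom.refl (τ : Tables ν) : Tables.Dom τ τ :=
  ⟨fun _ _ _ => le_rfl, fun _ _ _ => le_rfl, fun _ _ _ => le_rfl, fun _ _ _ => le_rfl⟩

/-- The entrywise order is transitive. [folklore] -/
theorem Tables.Dom.trans {τ₁ τ₂ τ₃ : Tables ν} (h₁ : Tables.Dom τ₁ τ₂) (h₂ : Tables.Dom τ₂ τ₃) : Tables.Dom τ₁ τ₃ :=
  ⟨fun n l v => (h₁.IM n l v).trans (h₂.IM n l v), fun n l v => (h₁.T n l v).trans (h₂.T n l v),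
    fun n l v => (h₁.U n l v).trans (h₂.U n l v), fun n l v => (h₁.K n l v).trans (h₂.K n l v)⟩

/-- Non-negativity ascends along the entrywise order: if `τ ≥ 0` entrywise and `τ ≤ τ'`, then `τ' ≥ 0`. [folklore] -/
theorem Tables.Nonneg.of_dom {τ τ' : Tables ν} (hτ : τ.Nonneg) (h : Tables.Dom τ τ') : τ'.Nonneg :=
  ⟨fun n l v => (hτ.IM n l v).trans (h.IM n l v), fun n l v => (hτ.T n l v).trans (h.T n l v),
    fun n l v => (hτ.U n l v).trans (h.U n l v), fun n l v => (hτ.K n l v).trans (h.K n l v)⟩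

section TablesMono

variable {τ τ' : Tables ν} (h : Tables.Dom τ τ') {a : Args}

/-- `m3 ≥ 0`. [folklore] -/
theorem m3_nonneg (a : Args) : 0 ≤ m3 a := (abs_nonneg _).trans (le_max_left _ _)

include h

/-- (3.71) (`BoundH[1]`) is monotone in the tables on well-formed arguments. [folklore] -/
theorem boundH1_tmono (ha : a.WF) (n l : ℕ) (v : ν) : boundH1 τ n l v a ≤ boundH1 τ' n l v a := by
  obtain ⟨hG, hcp, haf, hafx, hap, hRp, hRfD, hRpD, hK⟩ := ha
  have hIM := h.IM; have hT := h.T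
  match n with
  | 0 =>
    have := hIM 0 l v; have := hIM 0 (l+1) v; have := hIM (-1) l v
    simp only [boundH1]; gcongr
  | 1 =>
    have := hIM 1 l v; have := hIM 0 l v; have := hIM 1 (l+1) v; have := hIM 0 (l+1) v
    have := hIM 1 (l+2) v; have := hT 3 l v; have := hT 3 (l+1) v; have := hT 2 l v
    simp only [boundH1]; gcongr
  | 2 =>
    have := hIM 2 l v; have := hIM 1 l v; have := hIM 2 (l+1) v; have := hIM 1 (l+1) v
    have := hIM 2 (l+2) v; have := hIM 1 (l+2) v; have := hIM 2 (l+3) v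
    have := hT 4 l v; have := hT 4 (l+1) v; have := hT 3 l v; have := hT 4 (l+2) v; have := hT 3 (l+1) v
    simp only [boundH1]; gcongr
  | _ + 3 => simp only [boundH1]; exact le_rfl

/-- (3.74) (`BoundH[2]`) is monotone in the tables on well-formed arguments. [folklore] -/
theorem boundH2_tmono (ha : a.WF) (n l : ℕ) (v : ν) : boundH2 τ n l v a ≤ boundH2 τ' n l v a := by
  obtain ⟨hG, hcp, haf, hafx, hap, hRp, hRfD, hRpD, hK⟩ := ha
  have := h.T (n+2) l v; have := h.T (n+2) (l+1) v; have := h.T (n+1) l v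
  simp only [boundH2]
  gcongr

/-- (3.77) (`BoundH[3]`) is monotone in the tables on well-formed arguments. [folklore] -/
theorem boundH3_tmono (ha : a.WF) (n l : ℕ) (v : ν) : boundH3 τ n l v a ≤ boundH3 τ' n l v a := by
  have hm := m3_nonneg a
  obtain ⟨hG, hcp, haf, hafx, hap, hRp, hRfD, hRpD, hK⟩ := ha
  have := h.U (n+2) l v; have := h.U (n+3) l v
  simp only [boundH3]
  gcongr

/-- The M3-patched (3.77) is monotone in the tables on well-formed arguments. [folklore] -/
theorem boundH3Mono_tmono (ha : a.WF) (n l : ℕ) (v : ν) : boundH3Mono τ n l v a ≤ boundH3Mono τ' n l v a := by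
  have hm := m3Mono_nonneg a
  obtain ⟨hG, hcp, haf, hafx, hap, hRp, hRfD, hRpD, hK⟩ := ha
  have := h.U (n+2) l v; have := h.U (n+3) l v
  simp only [boundH3Mono]
  gcongr

/-- (3.78) as printed (`BoundH[4]`) is monotone in the tables on well-formed arguments. [folklore] -/
theorem boundH4_tmono (ha : a.WF) (n l : ℕ) (v : ν) : boundH4 τ n l v a ≤ boundH4 τ' n l v a := by
  obtain ⟨hG, hcp, haf, hafx, hap, hRp, hRfD, hRpD, hK⟩ := ha
  have := h.K n l v; have := h.K (n+1) l v
  simp only [boundH4]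
  gcongr

/-- The App.-C-consistent Step-4 summand (`boundH4D75`) is monotone in the tables on well-formed arguments. [folklore] -/
theorem boundH4D75_tmono (ha : a.WF) (n l : ℕ) (v : ν) : boundH4D75 τ n l v a ≤ boundH4D75 τ' n l v a := by
  obtain ⟨hG, hcp, haf, hafx, hap, hRp, hRfD, hRpD, hK⟩ := ha
  have := h.K (n+1) l v; have := h.K (n+2) l v
  simp only [boundH4D75]
  gcongr

/-- (3.86) (`BoundH[5]`) is monotone in the tables on well-formed arguments. [folklore] -/
theorem boundH5_tmono (ha : a.WF) (n l : ℕ) (v : ν) : boundH5 τ n l v a ≤ boundH5 τ' n l v a := by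
  obtain ⟨hG, hcp, haf, hafx, hap, hRp, hRfD, hRpD, hK⟩ := ha
  have := h.U (n+3) l v; have := h.U (n+2) l v
  simp only [boundH5]
  gcongr

/-- The numerator of (3.87) (`BoundH`) is monotone in the tables on well-formed arguments. [folklore] -/
theorem boundH_tmono (ha : a.WF) (n l : ℕ) (v : ν) : boundH τ n l v a ≤ boundH τ' n l v a := by
  unfold boundH
  gcongr
  · exact boundH1_tmono h ha n l v
  · exact boundH2_tmono h ha n l v
  · exact boundH3_tmono h ha n l v
  · exact boundH4_tmono h ha n l v
  · exact boundH5_tmono h ha n l v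

/-- The M3-patched numerator (`boundHMono`) is monotone in the tables on well-formed arguments. [folklore] -/
theorem boundHMono_tmono (ha : a.WF) (n l : ℕ) (v : ν) : boundHMono τ n l v a ≤ boundHMono τ' n l v a := by
  unfold boundHMono
  gcongr
  · exact boundH1_tmono h ha n l v
  · exact boundH2_tmono h ha n l v
  · exact boundH3Mono_tmono h ha n l v
  · exact boundH4_tmono h ha n l v
  · exact boundH5_tmono h ha n l v

/-- The App.-C-consistent numerator (`boundHD75`) is monotone in the tables on well-formed arguments. [folklore] -/
theorem boundHD75_tmono (ha : a.WF) (n l : ℕ) (v : ν) : boundHD75 τ n l v a ≤ boundHD75 τ' n l v a := by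
  unfold boundHD75
  gcongr
  · exact boundH1_tmono h ha n l v
  · exact boundH2_tmono h ha n l v
  · exact boundH3_tmono h ha n l v
  · exact boundH4D75_tmono h ha n l v
  · exact boundH5_tmono h ha n l v

/-- Its M3-patched form (`boundHMonoD75`) is monotone in the tables on well-formed arguments. [folklore] -/
theorem boundHMonoD75_tmono (ha : a.WF) (n l : ℕ) (v : ν) : boundHMonoD75 τ n l v a ≤ boundHMonoD75 τ' n l v a := by
  unfold boundHMonoD75
  gcongr
  · exact boundH1_tmono h ha n l v
  · exact boundH2_tmono h ha n l v
  · exact boundH3Mono_tmono h ha n l v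
  · exact boundH4D75_tmono h ha n l v
  · exact boundH5_tmono h ha n l v

omit h in
/-- A cellwise-monotone `foldr max` is monotone. [folklore] -/
theorem foldr_max_le_foldr_max {f g : ν → ℝ} (hfg : ∀ v, f v ≤ g v) {x y : ℝ} (hxy : x ≤ y) (vs : List ν) :
    vs.foldr (fun v acc => max (f v) acc) x ≤ vs.foldr (fun v acc => max (g v) acc) y := by
  induction vs with
  | nil => simpa using hxy
  | cons v vs ih =>
    simp only [List.foldr_cons]
    exact max_le_max (hfg v) ih

/-- The cell maximum `BoundFThree` is monotone in the tables on well-formed arguments. [folklore] -/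
theorem boundFThree_tmono (ha : a.WF) (n l : ℕ) (v₀ : ν) (vs : List ν) :
    boundFThree τ n l v₀ vs a ≤ boundFThree τ' n l v₀ vs a := by
  unfold boundFThree
  exact foldr_max_le_foldr_max (fun v => boundH_tmono h ha n l v) (boundH_tmono h ha n l v₀) vs

/-- `boundFThreeMono` is monotone in the tables on well-formed arguments. [folklore] -/
theorem boundFThreeMono_tmono (ha : a.WF) (n l : ℕ) (v₀ : ν) (vs : List ν) :
    boundFThreeMono τ n l v₀ vs a ≤ boundFThreeMono τ' n l v₀ vs a := by
  unfold boundFThreeMono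
  exact foldr_max_le_foldr_max (fun v => boundHMono_tmono h ha n l v) (boundHMono_tmono h ha n l v₀) vs

/-- `boundFThreeD75` is monotone in the tables on well-formed arguments. [folklore] -/
theorem boundFThreeD75_tmono (ha : a.WF) (n l : ℕ) (v₀ : ν) (vs : List ν) :
    boundFThreeD75 τ n l v₀ vs a ≤ boundFThreeD75 τ' n l v₀ vs a := by
  unfold boundFThreeD75
  exact foldr_max_le_foldr_max (fun v => boundHD75_tmono h ha n l v) (boundHD75_tmono h ha n l v₀) vs

/-- `boundFThreeMonoD75` is monotone in the tables on well-formed arguments. [folklore] -/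
theorem boundFThreeMonoD75_tmono (ha : a.WF) (n l : ℕ) (v₀ : ν) (vs : List ν) :
    boundFThreeMonoD75 τ n l v₀ vs a ≤ boundFThreeMonoD75 τ' n l v₀ vs a := by
  unfold boundFThreeMonoD75
  exact foldr_max_le_foldr_max (fun v => boundHMonoD75_tmono h ha n l v) (boundHMonoD75_tmono h ha n l v₀) vs

/-- The initial-point cells `BoundFThreeInital` (exponent `n+1`) are monotone in the `IM` table for `rho ≥ 0`, `d ≥ 1`.
[folklore] -/
theorem boundFThreeInitial_tmono {d : ℝ} (hd : 1 ≤ d) (n l : ℕ) {rho : ℝ} (h0 : 0 ≤ rho) (v₀ : ν) (vs : List ν) :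
    boundFThreeInitial τ d n l rho v₀ vs ≤ boundFThreeInitial τ' d n l rho v₀ vs := by
  unfold boundFThreeInitial
  have hq : 0 ≤ ((2*d-2)/(2*d-1)) ^ (n+1) := pow_nonneg (div_nonneg (by linarith) (by linarith)) _
  have step : ∀ v, rho * ((2*d-2)/(2*d-1)) ^ (n+1) * τ.IM n l v ≤ rho * ((2*d-2)/(2*d-1)) ^ (n+1) * τ'.IM n l v :=
    fun v => mul_le_mul_of_nonneg_left (h.IM n l v) (mul_nonneg h0 hq)
  exact foldr_max_le_foldr_max step (step v₀) vs

/-- The printed initial-point cells (exponent `1`) are monotone in the `IM` table for `rho ≥ 0`, `d ≥ 1`. [folklore] -/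
theorem boundFThreeInitialPrinted_tmono {d : ℝ} (hd : 1 ≤ d) (n l : ℕ) {rho : ℝ} (h0 : 0 ≤ rho) (v₀ : ν)
    (vs : List ν) :
    boundFThreeInitialPrinted τ d n l rho v₀ vs ≤ boundFThreeInitialPrinted τ' d n l rho v₀ vs := by
  unfold boundFThreeInitialPrinted
  have hq : 0 ≤ (2*d-2)/(2*d-1) := div_nonneg (by linarith) (by linarith)
  have step : ∀ v, rho * ((2*d-2)/(2*d-1)) * τ.IM n l v ≤ rho * ((2*d-2)/(2*d-1)) * τ'.IM n l v :=
    fun v => mul_le_mul_of_nonneg_left (h.IM n l v) (mul_nonneg h0 hq)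
  exact foldr_max_le_foldr_max step (step v₀) vs

end TablesMono

end F3Bounds

end Literature.Probability.FitznerVanDerHofstad2017
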